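import Literature.AlgebraicGeometry.Motives.HodgeThetaSubalgebraLeviCorners
import HarnessLib

/-!
# Corner LINES of a Lie algebra of operators `𝔏 ∋ E`: the SKELETON DECOMPOSITIONS `y = λE + bM₀` (`yE = y`),
# `y = λE + aN₀` (`Ey = y`), the surjectivity of a corner generator and an eigenvector of `N₀M₀`
# (brick R3b of the `r = 3` leg of the rank-twelve crux; Moonen–Zarhin 1999 (2.5); classification-free)

Family `hodge`, layer `Literature/AlgebraicGeometry/Motives` (pure complex linear algebra; no geometry).  Written for the cell
`pub-hodgeav-hg6` (LADDER-HodgeAV row 2, TABLE X row 1 `g6.I(1)`: the `r = 3` return leg of `RankTwelveSimpleCrux34`; eng-2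
lineage g5; honest framing of that cell: HC / HC_AV / HC_CM NOT proved — THIS file is unconditional linear algebra).
UNCONDITIONAL; theorems only — no definition, no named fact (D-0026), no `sorry`.

SETTING (the output of `LeviCorner.exists_generator` for `E` and for `1 − E`).  `𝔏 ⊆ End(W)` closed under the commutator;
`E ∈ 𝔏` idempotent; the UPPER corner `{N ∈ 𝔏 : EN = N, NE = 0}` is the line `ℂN₀` and the LOWER corner
`{M ∈ 𝔏 : EM = 0, ME = M}` is the line `ℂM₀`; `N₀` maps `ker E` onto `range E`.

WHAT IS PROVED.
* §1 **`LeviCorner.surjOn_of_injOn`** — an upper-corner `N₀` injective on `ker E` with `dim ker E = dim range E` maps `ker E`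
  ONTO `range E`; **`LeviCorner.exists_eigenvector_mul`** — with `M₀` (lower corner) injective on `range E` as well, `N₀M₀` has an
  eigenvector `u ∈ range E`, `u ≠ 0`, with NON-ZERO eigenvalue.
* §2 **`LeviCorner.eq_smul_add_smul_of_mul_idem`** — every `y ∈ 𝔏` with `yE = y` is `λE + bM₀`;
  **`LeviCorner.eq_smul_add_smul_of_idem_mul`** — every `y ∈ 𝔏` with `Ey = y` is `λE + aN₀`
  (Peirce decomposition of `y` at `E` — `LeviCorner.diag_mem` —, the vanishing corners, and `[d, N₀] ∈ ℂN₀` for the diagonal part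
  `d`, which forces `d = λE` because `N₀(ker E) = range E`).  Applied to `1 − E` (whose upper corner is `ℂM₀`) these give the
  mirror decompositions `y(1−E) = y ⟹ y = λ(1−E) + bN₀`, `(1−E)y = y ⟹ y = λ(1−E) + aM₀`.
SEQUEL (same cell, brick R4): for the Levi algebra of a minimal raising tripotent of rank `3` these decompositions pin down
`xC|_P`, `xC′|_P`, `Bz|_P`, `B′z|_P` for raising `x` and lowering `z`, and an invariant plane contradicts irreducibility.

## References
* [MoonenZarhin1999LowDim] B. Moonen, Yu. Zarhin, Math. Ann. 315 (1999), §2 (2.5).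
* [Humphreys1972] J. E. Humphreys, *Introduction to Lie Algebras and Representation Theory*, §19.1.
* [HoffmanKunze1971LinearAlgebra] K. Hoffman, R. Kunze, *Linear Algebra*, §6.7 (projections), §6.2 (eigenvalues).
-/

noncomputable section

open Module

namespace Literature.AlgebraicGeometry.Motives

namespace HodgeStructure

variable {W : Type*} [AddCommGroup W] [Module ℂ W]

/-! ### §1 Surjectivity of a corner generator; an eigenvector of `N₀M₀` -/

section Generator

variable [FiniteDimensional ℂ W]

/-- **An upper-corner element injective on `ker E` maps `ker E` onto `range E`** when `dim ker E = dim range E`.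
[cite: HoffmanKunze1971LinearAlgebra, §6.7] [cite: MoonenZarhin1999LowDim, §2 (2.5)] -/
theorem LeviCorner.surjOn_of_injOn {E N₀ : Module.End ℂ W} (hEN₀ : E * N₀ = N₀)
    (hdim : finrank ℂ (LinearMap.ker E) = finrank ℂ (LinearMap.range E))
    (hinj : ∀ x, E x = 0 → N₀ x = 0 → x = 0) : ∀ w, ∃ x, E x = 0 ∧ N₀ x = E w := by
  have hN₀K : ∀ x : LinearMap.ker E, N₀ (x : W) ∈ LinearMap.range E := fun x =>
    ⟨N₀ x, by rw [← Module.End.mul_apply, hEN₀]⟩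
  let f₀ : LinearMap.ker E →ₗ[ℂ] LinearMap.range E := (N₀ ∘ₗ (LinearMap.ker E).subtype).codRestrict _ hN₀K
  have hf₀inj : Function.Injective f₀ := by
    rw [← LinearMap.ker_eq_bot, Submodule.eq_bot_iff]
    intro x hx
    have h := congrArg Subtype.val (LinearMap.mem_ker.1 hx)
    exact Subtype.ext (hinj x (LinearMap.mem_ker.1 x.2) h)
  have hsurj : Function.Surjective f₀ := (LinearMap.injective_iff_surjective_of_finrank_eq_finrank hdim).1 hf₀inj
  intro w
  have hEw : E w ∈ LinearMap.range E := LinearMap.mem_range_self E w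
  obtain ⟨x, hx⟩ := hsurj ⟨E w, hEw⟩
  exact ⟨x, LinearMap.mem_ker.1 x.2, congrArg Subtype.val hx⟩

set_option maxHeartbeats 800000 in
/-- **An eigenvector of `N₀M₀` in `range E` with non-zero eigenvalue**, for an upper-corner `N₀` injective on `ker E` and a
lower-corner `M₀` injective on `range E` (`range E ≠ 0`). [cite: HoffmanKunze1971LinearAlgebra, §6.2]
[cite: MoonenZarhin1999LowDim, §2 (2.5)] -/
theorem LeviCorner.exists_eigenvector_mul {E N₀ M₀ : Module.End ℂ W} (hEE : E * E = E) (hEN₀ : E * N₀ = N₀)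
    (hEM₀ : E * M₀ = 0) (hpos : 0 < finrank ℂ (LinearMap.range E))
    (hN₀inj : ∀ x, E x = 0 → N₀ x = 0 → x = 0) (hM₀inj : ∀ x, E x = x → M₀ x = 0 → x = 0) :
    ∃ u : W, E u = u ∧ u ≠ 0 ∧ ∃ g : ℂ, g ≠ 0 ∧ N₀ (M₀ u) = g • u := by
  classical
  have hEEv : ∀ w, E (E w) = E w := fun w => by rw [← Module.End.mul_apply, hEE]
  have hinv : ∀ x ∈ LinearMap.range E, (N₀ * M₀) x ∈ LinearMap.range E := fun x _ =>
    ⟨N₀ (M₀ x), by rw [Module.End.mul_apply, ← Module.End.mul_apply E N₀, hEN₀]⟩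
  let G : Module.End ℂ ↥(LinearMap.range E) := (N₀ * M₀).restrict hinv
  haveI : Nontrivial ↥(LinearMap.range E) := Module.finrank_pos_iff.1 hpos
  obtain ⟨g, hg⟩ := Module.End.exists_eigenvalue G
  obtain ⟨u₀, hu₀⟩ := hg.exists_hasEigenvector
  have hGu : G u₀ = g • u₀ := hu₀.apply_eq_smul
  have hu₀0 : u₀ ≠ 0 := hu₀.2
  have hEu : E (u₀ : W) = u₀ := by
    obtain ⟨w, hw⟩ := u₀.2
    rw [← hw, hEEv]
  have hNMu : N₀ (M₀ (u₀ : W)) = g • (u₀ : W) := by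
    have h := congrArg Subtype.val hGu
    rw [Submodule.coe_smul] at h
    exact h
  refine ⟨u₀, hEu, fun h => hu₀0 (Subtype.ext h), g, fun hg0 => hu₀0 (Subtype.ext ?_), hNMu⟩
  rw [hg0, zero_smul] at hNMu
  have hM₀u : E (M₀ (u₀ : W)) = 0 := by rw [← Module.End.mul_apply, hEM₀, LinearMap.zero_apply]
  have h1 : M₀ (u₀ : W) = 0 := hN₀inj _ hM₀u hNMu
  exact hM₀inj _ hEu h1

end Generator

/-! ### §2 The skeleton decompositions -/

set_option maxHeartbeats 1600000 in
/-- **`yE = y` ⟹ `y = λE + bM₀`.**  `𝔏` bracket-closed; `E ∈ 𝔏` idempotent; `N₀ ∈ 𝔏` with `EN₀ = N₀`, `N₀E = 0`, spanning the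
upper corner and mapping `ker E` onto `range E`; `M₀` spanning the lower corner.  Then every `y ∈ 𝔏` with `yE = y` is
`λ·E + b·M₀`. [cite: MoonenZarhin1999LowDim, §2 (2.5)] [cite: Humphreys1972, §19.1] -/
theorem LeviCorner.eq_smul_add_smul_of_mul_idem {𝔏 : Submodule ℂ (Module.End ℂ W)}
    (hbr : ∀ A ∈ 𝔏, ∀ A' ∈ 𝔏, A * A' - A' * A ∈ 𝔏) {E N₀ M₀ : Module.End ℂ W} (hE : E ∈ 𝔏) (hEE : E * E = E)
    (hN₀ : N₀ ∈ 𝔏) (hN₀E : N₀ * E = 0)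
    (hupper : ∀ N ∈ 𝔏, E * N = N → N * E = 0 → ∃ c : ℂ, N = c • N₀)
    (hN₀sur : ∀ w, ∃ x, E x = 0 ∧ N₀ x = E w)
    (hlower : ∀ M ∈ 𝔏, E * M = 0 → M * E = M → ∃ c : ℂ, M = c • M₀)
    {y : Module.End ℂ W} (hy : y ∈ 𝔏) (hyE : y * E = y) : ∃ l b : ℂ, y = l • E + b • M₀ := by
  obtain ⟨-, hm, -, -⟩ := LeviCorner.diag_mem hbr hE hEE hy
  have hy1 : y * (1 - E) = 0 := by rw [mul_sub, mul_one, hyE, sub_self]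
  -- the lower corner part `(1 − E) y`
  have hm' : (1 - E) * y ∈ 𝔏 := by rwa [mul_assoc, hyE] at hm
  obtain ⟨b, hb⟩ := hlower _ hm' (by rw [← mul_assoc, mul_sub, mul_one, hEE, sub_self, zero_mul])
    (by rw [mul_assoc, hyE])
  -- the diagonal part `d = E y` and `[d, N₀] = d N₀ ∈ ℂ N₀`
  have hd : E * y ∈ 𝔏 := by
    have h : E * y = y - (1 - E) * y := by rw [sub_mul, one_mul, sub_sub_cancel]
    rw [h]
    exact 𝔏.sub_mem hy hm'
  have hN₀d : N₀ * (E * y) = 0 := by rw [← mul_assoc, hN₀E, zero_mul]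
  have hdN₀ : E * y * N₀ ∈ 𝔏 := by
    have h := hbr _ hd _ hN₀
    rwa [hN₀d, sub_zero] at h
  obtain ⟨l, hl⟩ := hupper _ hdN₀ (by rw [← mul_assoc, ← mul_assoc, hEE]) (by rw [mul_assoc, hN₀E, mul_zero])
  refine ⟨l, b, LinearMap.ext fun w => ?_⟩
  obtain ⟨x, -, hxw⟩ := hN₀sur w
  have h0 : (E * y) (w - E w) = 0 := by
    have e : (E * y) (w - E w) = (E * (y * (1 - E))) w := by
      simp only [Module.End.mul_apply, LinearMap.sub_apply, Module.End.one_apply, map_sub]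
    rw [e, hy1, mul_zero, LinearMap.zero_apply]
  have h1 : (E * y) (E w) = l • E w := by rw [← hxw, ← Module.End.mul_apply, hl, LinearMap.smul_apply]
  calc y w = (E * y) w + ((1 - E) * y) w := by
        rw [← LinearMap.add_apply, ← add_mul, add_sub_cancel, one_mul]
    _ = (E * y) (E w + (w - E w)) + (b • M₀) w := by rw [add_sub_cancel, hb]
    _ = l • E w + b • M₀ w := by rw [map_add, h0, add_zero, h1, LinearMap.smul_apply]
    _ = (l • E + b • M₀) w := by rw [LinearMap.add_apply, LinearMap.smul_apply, LinearMap.smul_apply]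

set_option maxHeartbeats 1600000 in
/-- **`Ey = y` ⟹ `y = λE + aN₀`.**  Same setting (only the upper corner line and the surjectivity of `N₀` are used).
[cite: MoonenZarhin1999LowDim, §2 (2.5)] [cite: Humphreys1972, §19.1] -/
theorem LeviCorner.eq_smul_add_smul_of_idem_mul {𝔏 : Submodule ℂ (Module.End ℂ W)}
    (hbr : ∀ A ∈ 𝔏, ∀ A' ∈ 𝔏, A * A' - A' * A ∈ 𝔏) {E N₀ : Module.End ℂ W} (hE : E ∈ 𝔏) (hEE : E * E = E)
    (hN₀ : N₀ ∈ 𝔏) (hEN₀ : E * N₀ = N₀) (hN₀E : N₀ * E = 0)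
    (hupper : ∀ N ∈ 𝔏, E * N = N → N * E = 0 → ∃ c : ℂ, N = c • N₀)
    (hN₀sur : ∀ w, ∃ x, E x = 0 ∧ N₀ x = E w)
    {y : Module.End ℂ W} (hy : y ∈ 𝔏) (hEy : E * y = y) : ∃ l a : ℂ, y = l • E + a • N₀ := by
  obtain ⟨hn, -, -, -⟩ := LeviCorner.diag_mem hbr hE hEE hy
  -- the upper corner part `y (1 − E)`
  have hn' : y * (1 - E) ∈ 𝔏 := by rwa [hEy] at hn
  obtain ⟨a, ha⟩ := hupper _ hn' (by rw [← mul_assoc, hEy])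
    (by rw [mul_assoc, sub_mul, one_mul, hEE, sub_self, mul_zero])
  -- the diagonal part `d = y E` and `[d, N₀] = y N₀ ∈ ℂ N₀`
  have hd : y * E ∈ 𝔏 := by
    have h : y * E = y - y * (1 - E) := by rw [mul_sub, mul_one, sub_sub_cancel]
    rw [h]
    exact 𝔏.sub_mem hy hn'
  have hN₀y : N₀ * y = 0 := by rw [← hEy, ← mul_assoc, hN₀E, zero_mul]
  have hyN₀ : y * N₀ ∈ 𝔏 := by
    have h := hbr _ hd _ hN₀
    rwa [mul_assoc, hEN₀, ← mul_assoc, hN₀y, zero_mul, sub_zero] at h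
  obtain ⟨l, hl⟩ := hupper _ hyN₀ (by rw [← mul_assoc, hEy]) (by rw [mul_assoc, hN₀E, mul_zero])
  refine ⟨l, a, LinearMap.ext fun w => ?_⟩
  obtain ⟨x, -, hxw⟩ := hN₀sur w
  have h1 : y (E w) = l • E w := by rw [← hxw, ← Module.End.mul_apply, hl, LinearMap.smul_apply]
  calc y w = y (E w) + y (w - E w) := by rw [← map_add, add_sub_cancel]
    _ = l • E w + (y * (1 - E)) w := by rw [h1, Module.End.mul_apply, LinearMap.sub_apply, Module.End.one_apply]
    _ = (l • E + a • N₀) w := by rw [ha, LinearMap.add_apply, LinearMap.smul_apply, LinearMap.smul_apply]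

end HodgeStructure

end Literature.AlgebraicGeometry.Motives
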